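import Summits.BirchSwinnertonDyer.BirchSwinnertonDyer.Theses.PrintCf2
import Summits.BirchSwinnertonDyer.Rank1Residual.AdditivePotMult.ModelFree
import Summits.BirchSwinnertonDyer.BirchSwinnertonDyer.Theorems.PrintCFramBottomClassIndexLawFiveLeTransferCoprimeTwist
import Literature.NumberTheory.EllipticCurves.Milne1972.WeilRestrictionQuadraticBSDQuotientAnyModel
import Literature.NumberTheory.EllipticCurves.Wuthrich2014.ShaBoundProofs
import Literature.NumberTheory.EllipticCurves.CyclotomicIwasawaMainTheoremIrreducibleBaseChangeProofs
import Literature.NumberTheory.EllipticCurves.BurungaleCastellaSkinnerTian2022.CMPConverse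
import Literature.NumberTheory.EllipticCurves.Disegni2020.PAdicBSDRankOneMultiplicativeProofs
import Summits.BirchSwinnertonDyer.BirchSwinnertonDyer.Theorems.Rank2ObservatoryHeegnerField
import HarnessLib

/-!
# Crux `PrintCf2.SplitBadTwoRankOneOfFacts` (item stmt-BirchSwinnertonDyer-20368) and its halves
# `SplitBadTwoUpperHalfOfFacts` (27850) / `SplitBadTwoLowerHalfOfFacts` (27851): DESCENT ALONG THE CM FIELD —
# `BSD(E, p)` over `ℚ` versus the `p`-part of BSD for `E` over its own CM field `K₀`

Cell `bsd-print-cf2`, width seat `bsd-line-cf2-p1-w3` g3, road α′ (GL₁ over `K₀ = ℚ(√−7)`, continuing -w3 g2's K₀ road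
`Lines/rubin_value_two.lean`); `--supports stmt-BirchSwinnertonDyer-27850`. HONEST FRAMING: nothing here closes a crux or a
stub. Proved: the bookkeeping that relocates Miller's `BSD(E,p)` currency from `ℚ` to the CM FIELD of a CM curve — the home
of every `GL₁` method (Rubin 1991 §11, Gonzalez-Avilés 1997 Thm. A, Burungale–Flach 2024 Thm. 1.1 are statements on `E/F`,
`F ⊇ K₀`) — with NO Heegner field and NO anticyclotomic tower. For a CM curve `E/ℚ` with CM field `K₀ = ℚ(√d₀)`,
`d₀ = cmFieldDiscrOfJ (j E)`, the twist `E^{(d₀)}` is `ℚ`-ISOGENOUS to `E` (tree theorem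
`PrintCFram.RelativeAnchorTransfer.isIsogenous_quadraticTwist_cmFieldDiscrOfJ`), so in Milne's Weil-restriction identity
`BSD(E_{K₀}/K₀) = BSD(E/ℚ)·BSD(E^{(d₀)}/ℚ)` (named fact `Milne1972.bsdQuotient_baseChange_quadratic_anyModel`, ANY `K₀`-model
`V`, Dokchitser–Dokchitser's `C(E/K)`) the second factor equals the first modulo Cassels (named fact
`bsdRHS_eq_of_isIsogenous`) and `L(E,s) = L(E^{(d₀)},s)`. §1 (class-free, every prime `p`, every CM curve):
`#Ш_an(E_{K₀}/K₀)·#Ш(E/ℚ)² = #Ш_an(E/ℚ)²·#Ш(E_{K₀}/K₀)` (`shaFinite_and_shaAnOverC_mul_sq_eq`); hence the `p`-adic BSD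
DEFECT over `K₀` is TWICE the defect over `ℚ` (`padicValRat_defectC_eq_two_mul`); Miller's clauses descend
(`MissingUpperBoundAt W p → MissingUpperBoundOverCAt V p`, lower and exact likewise, no further input) and ascend GIVEN
the rationality of `#Ш_an(E/ℚ)` (the `K₀`-side sees only its square) — in analytic rank one that is Gross–Zagier 1986
Thm. I.(7.3) (`GrossZagier1986_thm_I_7_3`, via `Disegni2020.exists_rat_shaAn_eq_of_analyticRank_eq_one`).
§2 (the crux's class, `p = 2`): the children 27850 / 27851 and the parent 20368 follow BY NAME from 𝔅_split, Milne,
Gross–Zagier I.(7.3) and the corresponding `K₀`-SIDE statement — for every `W` of the class and every imaginary quadratic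
`K` with `d_K = −7`, the upper / lower / exact `2`-part of BSD for `W_K` over `K` on the canonical model `W.baseChange K`
— and CONVERSELY each child gives its `K₀`-side statement (the relocation loses nothing). The `K₀`-side statements are
RESEARCH (displayed as hypotheses, nothing asserted): `W_K` has CM by an order of `K ∋ √−7` over the ground field,
`2 = 𝔭𝔭̄` split, `W_K` additive at `𝔭`, `𝔭̄`, `rank W(K) = 2`; printed neighbours: Gonzalez-Avilés 1997 Thm. A (rank
`0`, `p = 2` INCLUDED), Burungale–Flach 2024 Thm. 1.1 (rank `0`, every `p`); no rank-one statement at `p = 2` is in print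
(cell DOSSIER §5). Road-α′ twin of the Heegner-frame bridges p638495/p639270 (LEAD g8) and p638826 (-w4 g3), which relocate
to Heegner fields `K ≠ K₀`. BSD is not proved by any of this; no summit statement is proved by this seat.
References: [Milne1972ArithmeticAV] §1 Thm. 1; [DokchitserDokchitserAnnals2010] §2.1; [MilneADT2006] I.7.3; [GrossZagier1986]
Thm. I.(7.3); [Miller2011LMS] Def. 1.1; Gonzalez-Avilés, Trans. AMS 349 (1997) Thm. A; [BurungaleFlach2024] Thm. 1.1.
-/

set_option autoImplicit false
set_option linter.dupNamespace false

noncomputable section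

open scoped Classical NumberField

namespace Summit.BirchSwinnertonDyer.BirchSwinnertonDyer.Theorems.PrintCf2.CMFieldDescent

open WeierstrassCurve NumberField Literature.NumberTheory.EllipticCurves
  Literature.NumberTheory.EllipticCurves.Rank1Residual Literature.NumberTheory.EllipticCurves.Rank1Residual.Typed
  Summit.BirchSwinnertonDyer.Rank1Residual Summit.BirchSwinnertonDyer.Rank1Residual.AdditivePotMult

/-! ## §1 Class-free: the CM-field descent of the `BSD(E,p)` defect (every prime `p`, every CM curve) -/

section ClassFree

variable {W : WeierstrassCurve ℚ} [W.IsElliptic] [W.IsGloballyMinimal]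
  {K : Type} [Field K] [NumberField K] {V : WeierstrassCurve K} [V.IsElliptic]

/-- **The square identity over the CM field.** `W/ℚ` globally minimal with CM, `K` quadratic with
`d_K = cmFieldDiscrOfJ (j W)` (the CM field), `V` any `K`-model of `W_K`, `Ш(W/ℚ)` finite; granted modularity (`hmod`),
Cassels (`hCas`) and Milne's any-model identity (`hMilneC`): `Ш(V/K)` is finite and `#Ш_an(V/K)·#Ш(W)² = #Ш_an(W)²·#Ш(V/K)`.
Proof: a globally minimal model `Wd` of `W^{(d_K)}` is `ℚ`-isogenous to `W` (`isIsogenous_quadraticTwist_cmFieldDiscrOfJ`), so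
Cassels' ratio formula `#Ш_an(W)·#Ш(Wd) = #Ш_an(Wd)·#Ш(W)` substitutes into (★) `AdditivePotMult.shaAnOverC_mul_eq`.
[cite: Milne1972ArithmeticAV, §1 Thm. 1 (through DokchitserDokchitserAnnals2010 §2.1)] [cite: MilneADT2006, Thm. I.7.3 and Remark I.7.4] -/
theorem shaFinite_and_shaAnOverC_mul_sq_eq (hmod : hasEntireLFunction_rat) (hCas : bsdRHS_eq_of_isIsogenous)
    (hMilneC : Milne1972.bsdQuotient_baseChange_quadratic_anyModel) (hCM : W.HasCM)
    (h2 : Module.finrank ℚ K = 2) (hdisc : NumberField.discr K = cmFieldDiscrOfJ W.j)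
    (hV : ∃ C : VariableChange K, C • W.baseChange K = V) (hfin : W.ShaFinite) :
    V.ShaFinite ∧ shaAnOverC V * (W.shaOrder : ℂ) ^ 2 = shaAn W ^ 2 * (V.shaOrder : ℂ) := by
  -- a globally minimal model `Wd` of the twist by `d_K = d₀`, `ℚ`-isogenous to `W`
  have hdK0 : ((NumberField.discr K : ℤ) : ℚ) ≠ 0 := by
    rw [hdisc]; exact_mod_cast X12.cmFieldDiscrOfJ_ne_zero_of_hasCM W hCM
  obtain ⟨Wd, _, _, C, hC⟩ := exists_isGloballyMinimal_smul_eq_quadraticTwist W hdK0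
  have hWd : ∃ C : VariableChange ℚ, C • W.quadraticTwist (NumberField.discr K : ℚ) = Wd :=
    ⟨C⁻¹, by rw [← hC, inv_smul_smul]⟩
  -- `W ∼ Wd` over `ℚ`
  have hiso : IsIsogenous W Wd := by
    have h1 := PrintCFram.RelativeAnchorTransfer.isIsogenous_quadraticTwist_cmFieldDiscrOfJ W hCM
    rw [← hdisc] at h1
    have h2 : IsIsogenous W (C⁻¹ • W.quadraticTwist ((NumberField.discr K : ℤ) : ℚ)) := h1.smul_right C⁻¹
    rwa [← hC, inv_smul_smul] at h2
  -- Cassels, Milne, (★)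
  obtain ⟨hfinD, hRHS⟩ := hCas W Wd hiso hfin
  obtain ⟨hshaK, hWR⟩ := hMilneC W K h2 Wd hWd V hV hfin hfinD
  refine ⟨hshaK, ?_⟩
  have hstar := shaAnOverC_mul_eq W K Wd V hmod h2 hWd hV hfin hfinD hWR
  -- Cassels' ratio formula `#Ш_an(W)·#Ш(Wd) = #Ш_an(Wd)·#Ш(W)`
  have hlead_eq : W.leadingLCoeff = Wd.leadingLCoeff := leadingLCoeff_eq_of_isIsogenous' hiso
  have hlead : Wd.leadingLCoeff ≠ 0 := WeierstrassCurve.leadingLCoeff_ne_zero_holds (hmod Wd)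
  have hsD : (Wd.shaOrder : ℂ) ≠ 0 := by exact_mod_cast (Wd.shaOrder_pos hfinD).ne'
  have hRHS0 : (Wd.bsdRHS : ℂ) ≠ 0 := by
    intro h0
    have h1 := Wuthrich2014.shaAn_mul_bsdRHS Wd
    rw [h0, mul_zero] at h1
    exact mul_ne_zero hlead hsD h1.symm
  have hratio : shaAn W * (Wd.shaOrder : ℂ) = shaAn Wd * (W.shaOrder : ℂ) := by
    have h1 := Wuthrich2014.shaAn_mul_bsdRHS W
    have h2 := Wuthrich2014.shaAn_mul_bsdRHS Wd
    rw [← hRHS, hlead_eq] at h1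
    have h3 : shaAn W * (Wd.shaOrder : ℂ) * (Wd.bsdRHS : ℂ) =
        shaAn Wd * (W.shaOrder : ℂ) * (Wd.bsdRHS : ℂ) := by
      linear_combination (Wd.shaOrder : ℂ) * h1 - (W.shaOrder : ℂ) * h2
    exact mul_right_cancel₀ hRHS0 h3
  -- combine
  have h4 : shaAnOverC V * (W.shaOrder : ℂ) ^ 2 * (Wd.shaOrder : ℂ) =
      shaAn W ^ 2 * (V.shaOrder : ℂ) * (Wd.shaOrder : ℂ) := by
    linear_combination (W.shaOrder : ℂ) * hstar - shaAn W * (V.shaOrder : ℂ) * hratio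
  exact mul_right_cancel₀ hsD h4

/-- **The `p`-adic BSD defect over the CM field is twice the defect over `ℚ`** (any prime `p`): with
`#Ш_an(W) = q`, `#Ш_an(V/K) = q'` rational, `q'·#Ш(W)² = q²·#Ш(V)` in `ℚ` with everything non-zero, hence
`ord_p q' − ord_p #Ш(V) = 2·(ord_p q − ord_p #Ш(W))`. [folklore] -/
theorem padicValRat_defectC_eq_two_mul (p : ℕ) [Fact p.Prime] (hmod : hasEntireLFunction_rat)
    (hCas : bsdRHS_eq_of_isIsogenous) (hMilneC : Milne1972.bsdQuotient_baseChange_quadratic_anyModel)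
    (hCM : W.HasCM) (h2 : Module.finrank ℚ K = 2) (hdisc : NumberField.discr K = cmFieldDiscrOfJ W.j)
    (hV : ∃ C : VariableChange K, C • W.baseChange K = V) (hfin : W.ShaFinite)
    {q q' : ℚ} (hq : shaAn W = (q : ℂ)) (hq' : shaAnOverC V = (q' : ℂ)) :
    padicValRat p q' - padicValNat p V.shaOrder =
      2 * (padicValRat p q - padicValNat p W.shaOrder) := by
  obtain ⟨hshaK, hid⟩ := shaFinite_and_shaAnOverC_mul_sq_eq hmod hCas hMilneC hCM h2 hdisc hV hfin
  have hsWq : (W.shaOrder : ℚ) ≠ 0 := by exact_mod_cast (W.shaOrder_pos hfin).ne'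
  have hsKq : (V.shaOrder : ℚ) ≠ 0 := by exact_mod_cast (V.shaOrder_pos hshaK).ne'
  have hq0 : q ≠ 0 := by
    intro h0; apply shaAn_ne_zero W hmod; rw [hq, h0, Rat.cast_zero]
  have hQ : q' * (W.shaOrder : ℚ) ^ 2 = q ^ 2 * (V.shaOrder : ℚ) := by
    have h : ((q' * (W.shaOrder : ℚ) ^ 2 : ℚ) : ℂ) = ((q ^ 2 * (V.shaOrder : ℚ) : ℚ) : ℂ) := by
      push_cast
      rw [← hq, ← hq']
      exact hid
    exact_mod_cast h
  have hq'0 : q' ≠ 0 := by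
    intro h0
    rw [h0, zero_mul] at hQ
    exact mul_ne_zero (pow_ne_zero 2 hq0) hsKq hQ.symm
  have hv := congrArg (padicValRat p) hQ
  rw [padicValRat.mul hq'0 (pow_ne_zero 2 hsWq), padicValRat.pow (W.shaOrder : ℚ),
    padicValRat.mul (pow_ne_zero 2 hq0) hsKq, padicValRat.pow q,
    padicValRat.of_nat, padicValRat.of_nat] at hv
  push_cast at hv ⊢
  linarith

/-- **Rationality transfers up**: `#Ш_an(V/K) = q²·#Ш(V)/#Ш(W)²` for `#Ш_an(W) = q`. [folklore] -/
theorem exists_rat_shaAnOverC_eq (hmod : hasEntireLFunction_rat) (hCas : bsdRHS_eq_of_isIsogenous)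
    (hMilneC : Milne1972.bsdQuotient_baseChange_quadratic_anyModel) (hCM : W.HasCM)
    (h2 : Module.finrank ℚ K = 2) (hdisc : NumberField.discr K = cmFieldDiscrOfJ W.j)
    (hV : ∃ C : VariableChange K, C • W.baseChange K = V) (hfin : W.ShaFinite)
    {q : ℚ} (hq : shaAn W = (q : ℂ)) :
    shaAnOverC V = ((q ^ 2 * V.shaOrder / (W.shaOrder : ℚ) ^ 2 : ℚ) : ℂ) := by
  obtain ⟨-, hid⟩ := shaFinite_and_shaAnOverC_mul_sq_eq hmod hCas hMilneC hCM h2 hdisc hV hfin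
  have hsW : (W.shaOrder : ℂ) ≠ 0 := by exact_mod_cast (W.shaOrder_pos hfin).ne'
  have hden : (W.shaOrder : ℂ) ^ 2 ≠ 0 := pow_ne_zero 2 hsW
  push_cast
  rw [eq_div_iff hden, ← hq]
  exact hid

/-- **Upper half descends to the CM field** (no further input): `MissingUpperBoundAt W p → MissingUpperBoundOverCAt V p`.
[cite: Miller2011LMS, Def. 1.1 (arXiv:1010.2431 p. 3)] -/
theorem missingUpperBoundOverCAt_of_missingUpperBoundAt (p : ℕ) [Fact p.Prime]
    (hmod : hasEntireLFunction_rat) (hCas : bsdRHS_eq_of_isIsogenous)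
    (hMilneC : Milne1972.bsdQuotient_baseChange_quadratic_anyModel) (hCM : W.HasCM)
    (h2 : Module.finrank ℚ K = 2) (hdisc : NumberField.discr K = cmFieldDiscrOfJ W.j)
    (hV : ∃ C : VariableChange K, C • W.baseChange K = V) (hfin : W.ShaFinite)
    (hU : MissingUpperBoundAt W p) : MissingUpperBoundOverCAt V p := by
  obtain ⟨q, hq, hle⟩ := hU
  have hq' := exists_rat_shaAnOverC_eq hmod hCas hMilneC hCM h2 hdisc hV hfin hq
  refine ⟨_, hq', ?_⟩
  have := padicValRat_defectC_eq_two_mul p hmod hCas hMilneC hCM h2 hdisc hV hfin hq hq'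
  linarith

/-- **Lower half descends to the CM field** (no further input): `MissingLowerBoundAt W p → MissingLowerBoundOverCAt V p`.
[cite: Miller2011LMS, Def. 1.1 (arXiv:1010.2431 p. 3)] -/
theorem missingLowerBoundOverCAt_of_missingLowerBoundAt (p : ℕ) [Fact p.Prime]
    (hmod : hasEntireLFunction_rat) (hCas : bsdRHS_eq_of_isIsogenous)
    (hMilneC : Milne1972.bsdQuotient_baseChange_quadratic_anyModel) (hCM : W.HasCM)
    (h2 : Module.finrank ℚ K = 2) (hdisc : NumberField.discr K = cmFieldDiscrOfJ W.j)
    (hV : ∃ C : VariableChange K, C • W.baseChange K = V) (hfin : W.ShaFinite)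
    (hL : MissingLowerBoundAt W p) : MissingLowerBoundOverCAt V p := by
  obtain ⟨q, hq, hle⟩ := hL
  have hq' := exists_rat_shaAnOverC_eq hmod hCas hMilneC hCM h2 hdisc hV hfin hq
  refine ⟨_, hq', ?_⟩
  have := padicValRat_defectC_eq_two_mul p hmod hCas hMilneC hCM h2 hdisc hV hfin hq hq'
  linarith

/-- **Exact `p`-part descends to the CM field**: `MissingPPartAt W p → MissingPPartOverCAt V p`.
[cite: Miller2011LMS, Def. 1.1 (arXiv:1010.2431 p. 3)] -/
theorem missingPPartOverCAt_of_missingPPartAt (p : ℕ) [Fact p.Prime]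
    (hmod : hasEntireLFunction_rat) (hCas : bsdRHS_eq_of_isIsogenous)
    (hMilneC : Milne1972.bsdQuotient_baseChange_quadratic_anyModel) (hCM : W.HasCM)
    (h2 : Module.finrank ℚ K = 2) (hdisc : NumberField.discr K = cmFieldDiscrOfJ W.j)
    (hV : ∃ C : VariableChange K, C • W.baseChange K = V) (hfin : W.ShaFinite)
    (hP : MissingPPartAt W p) : MissingPPartOverCAt V p := by
  obtain ⟨q, hq, hv⟩ := hP
  have hq' := exists_rat_shaAnOverC_eq hmod hCas hMilneC hCM h2 hdisc hV hfin hq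
  refine ⟨_, hq', ?_⟩
  have := padicValRat_defectC_eq_two_mul p hmod hCas hMilneC hCM h2 hdisc hV hfin hq hq'
  linarith

/-- **Upper half ASCENDS from the CM field, given the rationality of `#Ш_an(W)`**:
`(∃ q, #Ш_an(W) = q) → MissingUpperBoundOverCAt V p → MissingUpperBoundAt W p`. The rationality hypothesis is
necessary: the `K`-side sees only `#Ш_an(W)²`. [cite: Miller2011LMS, Def. 1.1 (arXiv:1010.2431 p. 3)] -/
theorem missingUpperBoundAt_of_missingUpperBoundOverCAt (p : ℕ) [Fact p.Prime]
    (hmod : hasEntireLFunction_rat) (hCas : bsdRHS_eq_of_isIsogenous)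
    (hMilneC : Milne1972.bsdQuotient_baseChange_quadratic_anyModel) (hCM : W.HasCM)
    (h2 : Module.finrank ℚ K = 2) (hdisc : NumberField.discr K = cmFieldDiscrOfJ W.j)
    (hV : ∃ C : VariableChange K, C • W.baseChange K = V) (hfin : W.ShaFinite)
    (hrat : ∃ q : ℚ, shaAn W = (q : ℂ)) (hU : MissingUpperBoundOverCAt V p) : MissingUpperBoundAt W p := by
  obtain ⟨q, hq⟩ := hrat
  obtain ⟨q', hq', hle⟩ := hU
  refine ⟨q, hq, ?_⟩
  have := padicValRat_defectC_eq_two_mul p hmod hCas hMilneC hCM h2 hdisc hV hfin hq hq'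
  linarith

/-- **Lower half ASCENDS from the CM field, given the rationality of `#Ш_an(W)`.**
[cite: Miller2011LMS, Def. 1.1 (arXiv:1010.2431 p. 3)] -/
theorem missingLowerBoundAt_of_missingLowerBoundOverCAt (p : ℕ) [Fact p.Prime]
    (hmod : hasEntireLFunction_rat) (hCas : bsdRHS_eq_of_isIsogenous)
    (hMilneC : Milne1972.bsdQuotient_baseChange_quadratic_anyModel) (hCM : W.HasCM)
    (h2 : Module.finrank ℚ K = 2) (hdisc : NumberField.discr K = cmFieldDiscrOfJ W.j)
    (hV : ∃ C : VariableChange K, C • W.baseChange K = V) (hfin : W.ShaFinite)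
    (hrat : ∃ q : ℚ, shaAn W = (q : ℂ)) (hL : MissingLowerBoundOverCAt V p) : MissingLowerBoundAt W p := by
  obtain ⟨q, hq⟩ := hrat
  obtain ⟨q', hq', hle⟩ := hL
  refine ⟨q, hq, ?_⟩
  have := padicValRat_defectC_eq_two_mul p hmod hCas hMilneC hCM h2 hdisc hV hfin hq hq'
  linarith

/-- **Exact `p`-part ASCENDS from the CM field, given rationality**:
`(∃ q, #Ш_an(W) = q) → MissingPPartOverCAt V p → MissingPPartAt W p`. [cite: Miller2011LMS, Def. 1.1 (arXiv:1010.2431 p. 3)] -/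
theorem missingPPartAt_of_missingPPartOverCAt (p : ℕ) [Fact p.Prime]
    (hmod : hasEntireLFunction_rat) (hCas : bsdRHS_eq_of_isIsogenous)
    (hMilneC : Milne1972.bsdQuotient_baseChange_quadratic_anyModel) (hCM : W.HasCM)
    (h2 : Module.finrank ℚ K = 2) (hdisc : NumberField.discr K = cmFieldDiscrOfJ W.j)
    (hV : ∃ C : VariableChange K, C • W.baseChange K = V) (hfin : W.ShaFinite)
    (hrat : ∃ q : ℚ, shaAn W = (q : ℂ)) (hP : MissingPPartOverCAt V p) : MissingPPartAt W p := by
  obtain ⟨q, hq⟩ := hrat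
  obtain ⟨q', hq', hv⟩ := hP
  refine ⟨q, hq, ?_⟩
  have := padicValRat_defectC_eq_two_mul p hmod hCas hMilneC hCM h2 hdisc hV hfin hq hq'
  linarith

/-- **`BSD(E,p)` ⟺ the `p`-part of BSD for `E` over its CM field**, in analytic rank `≤ 1` (GZK `hGZK` for
`rank = r_an` and finiteness; rationality of `#Ш_an(W)` displayed as `hrat`): for a quadratic `K` with
`d_K = cmFieldDiscrOfJ (j W)` and any `K`-model `V` of `W_K`, `BSDp W p ↔ MissingPPartOverCAt V p`.
[cite: Miller2011LMS, Def. 1.1 (arXiv:1010.2431 p. 3)] [cite: Milne1972ArithmeticAV, §1 Thm. 1] -/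
theorem bsdp_iff_missingPPartOverCAt_cmField (p : ℕ) [Fact p.Prime]
    (hGZK : rank_eq_analyticRank_of_analyticRank_le_one) (hmod : hasEntireLFunction_rat)
    (hCas : bsdRHS_eq_of_isIsogenous) (hMilneC : Milne1972.bsdQuotient_baseChange_quadratic_anyModel)
    (hCM : W.HasCM) (hr : W.analyticRank ≤ 1) (h2 : Module.finrank ℚ K = 2)
    (hdisc : NumberField.discr K = cmFieldDiscrOfJ W.j) (hV : ∃ C : VariableChange K, C • W.baseChange K = V)
    (hrat : ∃ q : ℚ, shaAn W = (q : ℂ)) : BSDp W p ↔ MissingPPartOverCAt V p := by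
  obtain ⟨-, hfin⟩ := hGZK W hr
  haveI : Finite W.sha := hfin
  refine ⟨fun h => missingPPartOverCAt_of_missingPPartAt p hmod hCas hMilneC hCM h2 hdisc hV hfin
      (missingPPartAt_of_bsdp W p h), fun h => ?_⟩
  exact bsdp_of_missingPPartAt W p hGZK hr
    (missingPPartAt_of_missingPPartOverCAt p hmod hCas hMilneC hCM h2 hdisc hV hfin hrat h)

end ClassFree

/-! ## §2 The crux's class (`p = 2`, `K₀ = ℚ(√−7)`): the child cruxes and the parent from their `K₀`-side forms, and back -/

section ClassLevel

-- An imaginary quadratic `K` with `d_K = −7` exists as a `Type`: the landed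
-- `Rank2Observatory.exists_heegnerField_5077a1` (file `Theorems/Rank2ObservatoryHeegnerField.lean`), reused below.

/-- In the class, `d_K = −7` is the CM discriminant: `CMSplit W 2 → cmFieldDiscrOfJ (j W) = −7`, so a field with
`d_K = −7` satisfies the §1 hypothesis `hdisc`. [cite: SilvermanATAEC1994, App. A §3] -/
theorem discr_eq_cmFieldDiscrOfJ_of_cmSplit_two {W : WeierstrassCurve ℚ} [W.IsElliptic] (hs : CMSplit W 2)
    {K : Type} [Field K] [NumberField K] (hdK : NumberField.discr K = -7) :
    NumberField.discr K = cmFieldDiscrOfJ W.j := by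
  rw [hdK, BurungaleCastellaSkinnerTian2022.cmFieldDiscrOfJ_eq_of_cmSplit_two W hs]

/-- **Child crux 27850 from its `K₀`-side form.** GIVEN the bundle 𝔅_split (its GZK, modularity and Cassels conjuncts
are used), Milne's any-model identity (`hMilneC`) and Gross–Zagier 1986 Thm. I.(7.3) (`hGZ`, for the rationality of
`#Ш_an(W)` in analytic rank one), the `K₀`-SIDE UPPER HALF `hU` — for every `W` of the class and every imaginary
quadratic `K` with `d_K = −7`, `ord₂ #Ш(W_K/K) ≤ ord₂ #Ш_an(W_K/K)` on the canonical model `W.baseChange K`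
(RESEARCH: Euler-system half of BSD₂ for a curve with CM by `K ∋ √−7` over `K` itself, `2` split, `E` additive at both
primes above `2`, `rank E(K) = 2`; rank-`0` neighbour in print: Gonzalez-Avilés 1997 Thm. A) — implies
`PrintCf2.SplitBadTwoUpperHalfOfFacts`. [cite: Miller2011LMS, Def. 1.1 (arXiv:1010.2431 p. 3)]
[cite: Milne1972ArithmeticAV, §1 Thm. 1] [cite: GrossZagier1986, Thm. I.(7.3) 2) (p. 231)] -/
theorem splitBadTwoUpperHalfOfFacts_of_upperOverCMField
    (hMilneC : Milne1972.bsdQuotient_baseChange_quadratic_anyModel) (hGZ : GrossZagier1986_thm_I_7_3)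
    (hU : ∀ (W : WeierstrassCurve ℚ) [W.IsElliptic] [W.IsGloballyMinimal], W.HasCM → W.analyticRank = 1 →
      CMSplit W 2 → ¬ Good W 2 → ∀ (K : Type) [Field K] [NumberField K], IsImaginaryQuadratic K →
      NumberField.discr K = -7 → MissingUpperBoundOverCAt (W.baseChange K) 2) :
    Summit.BirchSwinnertonDyer.BirchSwinnertonDyer.Theses.PrintCf2.SplitBadTwoUpperHalfOfFacts := by
  intro hB W _ _ hCM hr hs hng
  obtain ⟨hGZK, hmod, hCas, -, -⟩ := hB
  obtain ⟨K, _, _, hIQ, hdK⟩ := Rank2Observatory.exists_heegnerField_5077a1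
  haveI : (W.baseChange K).IsElliptic := by rw [baseChange]; infer_instance
  have hV : ∃ C : VariableChange K, C • W.baseChange K = W.baseChange K := ⟨1, one_smul _ _⟩
  obtain ⟨-, hfin⟩ := hGZK W (by omega)
  exact missingUpperBoundAt_of_missingUpperBoundOverCAt 2 hmod hCas hMilneC hCM hIQ.1
    (discr_eq_cmFieldDiscrOfJ_of_cmSplit_two hs hdK) hV hfin
    (Disegni2020.exists_rat_shaAn_eq_of_analyticRank_eq_one hGZ hGZK W hr) (hU W hCM hr hs hng K hIQ hdK)

/-- **Child crux 27851 from its `K₀`-side form** (the LOWER half over `K₀`: main-conjecture direction; same prints).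
[cite: Miller2011LMS, Def. 1.1 (arXiv:1010.2431 p. 3)] [cite: Milne1972ArithmeticAV, §1 Thm. 1]
[cite: GrossZagier1986, Thm. I.(7.3) 2) (p. 231)] -/
theorem splitBadTwoLowerHalfOfFacts_of_lowerOverCMField
    (hMilneC : Milne1972.bsdQuotient_baseChange_quadratic_anyModel) (hGZ : GrossZagier1986_thm_I_7_3)
    (hL : ∀ (W : WeierstrassCurve ℚ) [W.IsElliptic] [W.IsGloballyMinimal], W.HasCM → W.analyticRank = 1 →
      CMSplit W 2 → ¬ Good W 2 → ∀ (K : Type) [Field K] [NumberField K], IsImaginaryQuadratic K →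
      NumberField.discr K = -7 → MissingLowerBoundOverCAt (W.baseChange K) 2) :
    Summit.BirchSwinnertonDyer.BirchSwinnertonDyer.Theses.PrintCf2.SplitBadTwoLowerHalfOfFacts := by
  intro hB W _ _ hCM hr hs hng
  obtain ⟨hGZK, hmod, hCas, -, -⟩ := hB
  obtain ⟨K, _, _, hIQ, hdK⟩ := Rank2Observatory.exists_heegnerField_5077a1
  haveI : (W.baseChange K).IsElliptic := by rw [baseChange]; infer_instance
  have hV : ∃ C : VariableChange K, C • W.baseChange K = W.baseChange K := ⟨1, one_smul _ _⟩
  obtain ⟨-, hfin⟩ := hGZK W (by omega)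
  exact missingLowerBoundAt_of_missingLowerBoundOverCAt 2 hmod hCas hMilneC hCM hIQ.1
    (discr_eq_cmFieldDiscrOfJ_of_cmSplit_two hs hdK) hV hfin
    (Disegni2020.exists_rat_shaAn_eq_of_analyticRank_eq_one hGZ hGZK W hr) (hL W hCM hr hs hng K hIQ hdK)

/-- **The parent crux 20368 from its `K₀`-side form**: the exact `2`-part of BSD for `W_K` over `K` (`d_K = −7`) on the
canonical model, for every `W` of the class, gives `BSDp W 2` for every `W` of the class (same prints).
[cite: Miller2011LMS, Def. 1.1 (arXiv:1010.2431 p. 3)] [cite: Milne1972ArithmeticAV, §1 Thm. 1]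
[cite: GrossZagier1986, Thm. I.(7.3) 2) (p. 231)] -/
theorem splitBadTwoRankOneOfFacts_of_pPartOverCMField
    (hMilneC : Milne1972.bsdQuotient_baseChange_quadratic_anyModel) (hGZ : GrossZagier1986_thm_I_7_3)
    (hP : ∀ (W : WeierstrassCurve ℚ) [W.IsElliptic] [W.IsGloballyMinimal], W.HasCM → W.analyticRank = 1 →
      CMSplit W 2 → ¬ Good W 2 → ∀ (K : Type) [Field K] [NumberField K], IsImaginaryQuadratic K →
      NumberField.discr K = -7 → MissingPPartOverCAt (W.baseChange K) 2) :
    Summit.BirchSwinnertonDyer.BirchSwinnertonDyer.Theses.PrintCf2.SplitBadTwoRankOneOfFacts := by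
  intro hB W _ _ hCM hr hs hng
  obtain ⟨hGZK, hmod, hCas, -, -⟩ := hB
  obtain ⟨K, _, _, hIQ, hdK⟩ := Rank2Observatory.exists_heegnerField_5077a1
  haveI : (W.baseChange K).IsElliptic := by rw [baseChange]; infer_instance
  have hV : ∃ C : VariableChange K, C • W.baseChange K = W.baseChange K := ⟨1, one_smul _ _⟩
  exact (bsdp_iff_missingPPartOverCAt_cmField 2 hGZK hmod hCas hMilneC hCM (by omega) hIQ.1
    (discr_eq_cmFieldDiscrOfJ_of_cmSplit_two hs hdK) hV
    (Disegni2020.exists_rat_shaAn_eq_of_analyticRank_eq_one hGZ hGZK W hr)).2 (hP W hCM hr hs hng K hIQ hdK)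

/-- **Conversely, the child crux 27850 gives its `K₀`-side form** (on every imaginary quadratic `K` with `d_K = −7`,
canonical model; prints: 𝔅_split and Milne any-model): the relocation to `K₀` loses nothing.
[cite: Miller2011LMS, Def. 1.1 (arXiv:1010.2431 p. 3)] [cite: Milne1972ArithmeticAV, §1 Thm. 1] -/
theorem upperOverCMField_of_splitBadTwoUpperHalfOfFacts
    (hMilneC : Milne1972.bsdQuotient_baseChange_quadratic_anyModel)
    (hB : Literature.NumberTheory.EllipticCurves.rank_eq_analyticRank_of_analyticRank_le_one ∧
      WeierstrassCurve.hasEntireLFunction_rat ∧ WeierstrassCurve.bsdRHS_eq_of_isIsogenous ∧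
      Literature.NumberTheory.EllipticCurves.bsdTriple_of_hasCM_of_L_one_ne_zero ∧
      Literature.NumberTheory.EllipticCurves.KrizLi2019.thm112_bsdTwo_twist)
    (h : Summit.BirchSwinnertonDyer.BirchSwinnertonDyer.Theses.PrintCf2.SplitBadTwoUpperHalfOfFacts) :
    ∀ (W : WeierstrassCurve ℚ) [W.IsElliptic] [W.IsGloballyMinimal], W.HasCM → W.analyticRank = 1 →
      CMSplit W 2 → ¬ Good W 2 → ∀ (K : Type) [Field K] [NumberField K], IsImaginaryQuadratic K →
      NumberField.discr K = -7 → MissingUpperBoundOverCAt (W.baseChange K) 2 := by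
  intro W _ _ hCM hr hs hng K _ _ hIQ hdK
  obtain ⟨hGZK, hmod, hCas, -, -⟩ := id hB
  haveI : (W.baseChange K).IsElliptic := by rw [baseChange]; infer_instance
  have hV : ∃ C : VariableChange K, C • W.baseChange K = W.baseChange K := ⟨1, one_smul _ _⟩
  obtain ⟨-, hfin⟩ := hGZK W (by omega)
  exact missingUpperBoundOverCAt_of_missingUpperBoundAt 2 hmod hCas hMilneC hCM hIQ.1
    (discr_eq_cmFieldDiscrOfJ_of_cmSplit_two hs hdK) hV hfin (h hB W hCM hr hs hng)

/-- **Conversely, the child crux 27851 gives its `K₀`-side form.**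
[cite: Miller2011LMS, Def. 1.1 (arXiv:1010.2431 p. 3)] [cite: Milne1972ArithmeticAV, §1 Thm. 1] -/
theorem lowerOverCMField_of_splitBadTwoLowerHalfOfFacts
    (hMilneC : Milne1972.bsdQuotient_baseChange_quadratic_anyModel)
    (hB : Literature.NumberTheory.EllipticCurves.rank_eq_analyticRank_of_analyticRank_le_one ∧
      WeierstrassCurve.hasEntireLFunction_rat ∧ WeierstrassCurve.bsdRHS_eq_of_isIsogenous ∧
      Literature.NumberTheory.EllipticCurves.bsdTriple_of_hasCM_of_L_one_ne_zero ∧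
      Literature.NumberTheory.EllipticCurves.KrizLi2019.thm112_bsdTwo_twist)
    (h : Summit.BirchSwinnertonDyer.BirchSwinnertonDyer.Theses.PrintCf2.SplitBadTwoLowerHalfOfFacts) :
    ∀ (W : WeierstrassCurve ℚ) [W.IsElliptic] [W.IsGloballyMinimal], W.HasCM → W.analyticRank = 1 →
      CMSplit W 2 → ¬ Good W 2 → ∀ (K : Type) [Field K] [NumberField K], IsImaginaryQuadratic K →
      NumberField.discr K = -7 → MissingLowerBoundOverCAt (W.baseChange K) 2 := by
  intro W _ _ hCM hr hs hng K _ _ hIQ hdK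
  obtain ⟨hGZK, hmod, hCas, -, -⟩ := id hB
  haveI : (W.baseChange K).IsElliptic := by rw [baseChange]; infer_instance
  have hV : ∃ C : VariableChange K, C • W.baseChange K = W.baseChange K := ⟨1, one_smul _ _⟩
  obtain ⟨-, hfin⟩ := hGZK W (by omega)
  exact missingLowerBoundOverCAt_of_missingLowerBoundAt 2 hmod hCas hMilneC hCM hIQ.1
    (discr_eq_cmFieldDiscrOfJ_of_cmSplit_two hs hdK) hV hfin (h hB W hCM hr hs hng)

end ClassLevel

end Summit.BirchSwinnertonDyer.BirchSwinnertonDyer.Theorems.PrintCf2.CMFieldDescent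

end
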